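import Literature.AnabelianGeometry.SemiGraphs.PSCUnrLevelPackage
import Literature.AnabelianGeometry.SemiGraphs.PSCCompactifiedNodePackage
import Literature.AnabelianGeometry.SemiGraphs.PSCThm16iiiAssemblyProofs
import Literature.AnabelianGeometry.SemiGraphs.PSCNodeExistenceTransferProofs
import Literature.AnabelianGeometry.SemiGraphs.PSCCompactifiedGraphicProofs
import Literature.AnabelianGeometry.SemiGraphs.PSCGraphicFromSturdyLevelProofs
import HarnessLib

/-!
# [CombGC] Theorem 1.6 (ii), the writer's per-level packages (route 2 of the cell's sub-DAG)

Mochizuki, *A combinatorial version of the Grothendieck conjecture*, Tohoku Math. J. **59** (2007)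
[CombGC], proof of Theorem 1.6 (ii), author's manuscript p. 14: at every finite étale Galois level
`U` of a STURDY pair (`G_U`, `H_{α U}` of `Ω`-type, profinite, `Σ = {l}`) the cell's kernels produce
(cell file `plan/L3/SUBDAG-CombGC-Thm16.md`, §ASSEMBLY SPEC, writer abc-iut-w4-d052):

* `restrictBD_isGroupTheoreticallyCuspidal_of_holds` — "numerically cuspidal, hence group-theoretically
  cuspidal" for `α_U` (rows T16-L08 abc-iut-w5-d183, T16-L01/L03 abc-iut-w4-d052);
* `node_package_of_holds` — the level-`U` NODE package of abc-iut-w5-d188's descent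
  (`node_package_of_gtEdgeLike`): the induced `ᾱ_U` of the compactifications is group-theoretically
  edge-like ([IUTchI] Rmk. 1.2.3 (v) kernel at the noncuspidal `(G_U)'`, row T16-L10; the node-existence
  input derived, row T16-L10b);
* `vertex_package_of_holds` — the level-`U` VERTEX package (`graphic_mod_package_unr`): once `α` is
  group-theoretically edge-like, `β_U : Π^unr_{G_U} ⥲ Π^unr_{H_{α U}}` exists, is verticially
  filtration-preserving, hence (Thm. 1.6 (iii) assembled, `unrVerticialIff_holds_of_inputs`)
  group-theoretically verticial.

Every input is an origin statement BY NAME (`RankStatementsHold`, `CuspidalEdgeLikeCharacterizationHolds`,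
`NodalEdgeLikeCharacterizationHolds`, `CompactifyOfPSCTypeHolds`, `RestrictBDOfPSCTypeHolds`,
`OpenInterDeterminesComponentHolds`, `UnrVerticialCharacterizationHolds`, `UnrVertAbOfRankHolds`,
`VertCountLeNodeCountSuccHolds`) plus profiniteness `hprof`.  Proof-only (0 defs); nothing here takes
a side on [IUTchIII] Cor. 3.12. [cite: MochizukiCombGC2007, Thm 1.6(ii) p.14]
-/

noncomputable section

namespace Literature.AnabelianGeometry.SemiGraphs

namespace PSCDatum

open PSCCovering
open scoped Pointwise

universe u

variable (Ω : PSCOrigin.{u})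
variable {P : Type u} [Group P] [TopologicalSpace P] [IsTopologicalGroup P] [CompactSpace P]
  [TotallyDisconnectedSpace P]
variable {P' : Type u} [Group P'] [TopologicalSpace P'] [IsTopologicalGroup P'] [CompactSpace P']
  [TotallyDisconnectedSpace P']
variable {G : PSCDatum P} {H : PSCDatum P'} {α : P ≃ₜ* P'} {bd : G.BranchData} {bd' : H.BranchData}

/-! ### (i) at a sturdy level -/

/-- **"Numerically cuspidal, hence group-theoretically cuspidal" for `α_U`** at a level `U` whose
covering data are sturdy and of `Ω`-type (`Σ = {l}`), from `RankStatementsHold Ω` and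
`CuspidalEdgeLikeCharacterizationHolds Ω` BY NAME. [cite: MochizukiCombGC2007, Thm 1.6(ii) p.14] -/
theorem restrictBD_isGroupTheoreticallyCuspidal_of_holds (hrank : RankStatementsHold Ω)
    (hcuspΩ : CuspidalEdgeLikeCharacterizationHolds Ω) {l : ℕ} (hS : G.Sigma = {l})
    (hS' : H.Sigma = {l}) (hα : G.IsGraphicallyFiltrationPreserving H α)
    (U : Subgroup P) [U.Normal] [U.FiniteIndex] (hUo : IsOpen (U : Set P))
    [(U.map α.toMulEquiv.toMonoidHom).FiniteIndex]
    (hU'o : IsOpen ((U.map α.toMulEquiv.toMonoidHom : Subgroup P') : Set P'))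
    (hDΩ : Ω.IsOfPSCType (G.restrictBD U hUo bd))
    (hD'Ω : Ω.IsOfPSCType (H.restrictBD (U.map α.toMulEquiv.toMonoidHom) hU'o bd'))
    (hDs : (G.restrictBD U hUo bd).IsSturdy)
    (hD's : (H.restrictBD (U.map α.toMulEquiv.toMonoidHom) hU'o bd').IsSturdy) :
    (G.restrictBD U hUo bd).IsGroupTheoreticallyCuspidal
      (H.restrictBD (U.map α.toMulEquiv.toMonoidHom) hU'o bd') (restrictIso α rfl) := by
  haveI : CompactSpace U :=
    isCompact_iff_compactSpace.mp (Subgroup.isClosed_of_isOpen U hUo).isCompact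
  haveI : CompactSpace (U.map α.toMulEquiv.toMonoidHom) :=
    isCompact_iff_compactSpace.mp (Subgroup.isClosed_of_isOpen _ hU'o).isCompact
  obtain ⟨-, hdG, hcG, hnG⟩ := hrank _ hDΩ
  obtain ⟨-, hdH, hcH, hnH⟩ := hrank _ hD'Ω
  exact isGroupTheoreticallyCuspidal_of_isGraphicallyFiltrationPreserving_sturdy
    (by rw [restrictBD_Sigma, hS]) (by rw [restrictBD_Sigma, hS']) hDs hD's hdG hcG hnG hdH hcH hnH
    (hcuspΩ _ hDΩ) (hcuspΩ _ hD'Ω) (hα.restrictBD G H α hUo hU'o rfl bd bd')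

/-! ### The NODE package at a sturdy level -/

/-- **The level-`U` node package** (abc-iut-w5-d188's `node_package_of_gtEdgeLike` along the canonical
compactified quotients), at a level whose covering data are sturdy and of `Ω`-type, for `Σ = {l}` and
a graphically filtration-preserving `α`: the induced `ᾱ_U` of the compactifications exists
(`α_U` is group-theoretically cuspidal), is graphically filtration-preserving, the node-existence
correspondence holds (row T16-L10b), hence `ᾱ_U` is group-theoretically edge-like ([IUTchI]
Rmk. 1.2.3 (v) kernel at the noncuspidal compactified data), and Prop. 1.2 (i) separates the nodes.
Inputs BY NAME. [cite: MochizukiCombGC2007, Thm 1.6(ii) p.14] -/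
theorem node_package_of_holds (hrank : RankStatementsHold Ω)
    (hcuspΩ : CuspidalEdgeLikeCharacterizationHolds Ω) (hnodal : NodalEdgeLikeCharacterizationHolds Ω)
    (hcpt : CompactifyOfPSCTypeHolds Ω) (hopen : OpenInterDeterminesComponentHolds Ω)
    (hunr : UnrVerticialCharacterizationHolds Ω) (hrankv : UnrVertAbOfRankHolds Ω)
    (hconn : VertCountLeNodeCountSuccHolds Ω) {l : ℕ} (hS : G.Sigma = {l}) (hS' : H.Sigma = {l})
    (hα : G.IsGraphicallyFiltrationPreserving H α)
    (U : Subgroup P) [U.Normal] [U.FiniteIndex] (hUo : IsOpen (U : Set P))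
    [(U.map α.toMulEquiv.toMonoidHom).Normal] [(U.map α.toMulEquiv.toMonoidHom).FiniteIndex]
    (hU'o : IsOpen ((U.map α.toMulEquiv.toMonoidHom : Subgroup P') : Set P'))
    (hDΩ : Ω.IsOfPSCType (G.restrictBD U hUo bd))
    (hD'Ω : Ω.IsOfPSCType (H.restrictBD (U.map α.toMulEquiv.toMonoidHom) hU'o bd'))
    (hDs : (G.restrictBD U hUo bd).IsSturdy)
    (hD's : (H.restrictBD (U.map α.toMulEquiv.toMonoidHom) hU'o bd').IsSturdy) :
    ∃ (K' : Subgroup P') (_ : K'.Normal)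
      (e : (Σ n, DoubleCoset.Quotient (U : Set P) (G.nodeGp n : Set P)) ≃
        (Σ m, DoubleCoset.Quotient ((U.map α.toMulEquiv.toMonoidHom : Subgroup P') : Set P')
          (H.nodeGp m : Set P'))),
      (∀ (n : G.graph.N) (x : P) (m : H.graph.N) (y : P'),
        e ⟨n, DoubleCoset.mk U (G.nodeGp n) x⟩ =
            ⟨m, DoubleCoset.mk (U.map α.toMulEquiv.toMonoidHom) (H.nodeGp m) y⟩ →
          ∃ u' ∈ U.map α.toMulEquiv.toMonoidHom,
            (U ⊓ ConjAct.toConjAct x • G.nodeGp n).map α.toMulEquiv.toMonoidHom ⊔ K' =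
              ConjAct.toConjAct u' •
                ((U.map α.toMulEquiv.toMonoidHom ⊓ ConjAct.toConjAct y • H.nodeGp m) ⊔ K')) ∧
      (∀ (m₁ : H.graph.N) (y₁ : P') (m₂ : H.graph.N) (y₂ : P'),
        (∃ u' ∈ U.map α.toMulEquiv.toMonoidHom,
            (U.map α.toMulEquiv.toMonoidHom ⊓ ConjAct.toConjAct y₁ • H.nodeGp m₁) ⊔ K' =
              ConjAct.toConjAct u' •
                ((U.map α.toMulEquiv.toMonoidHom ⊓ ConjAct.toConjAct y₂ • H.nodeGp m₂) ⊔ K')) →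
          (⟨m₁, DoubleCoset.mk (U.map α.toMulEquiv.toMonoidHom) (H.nodeGp m₁) y₁⟩ :
              Σ m, DoubleCoset.Quotient ((U.map α.toMulEquiv.toMonoidHom : Subgroup P') : Set P')
                (H.nodeGp m : Set P')) =
            ⟨m₂, DoubleCoset.mk (U.map α.toMulEquiv.toMonoidHom) (H.nodeGp m₂) y₂⟩) := by
  set U' : Subgroup P' := U.map α.toMulEquiv.toMonoidHom with hU'def
  set D := G.restrictBD U hUo bd with hDdef
  set D' := H.restrictBD U' hU'o bd' with hD'def
  haveI : CompactSpace U :=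
    isCompact_iff_compactSpace.mp (Subgroup.isClosed_of_isOpen U hUo).isCompact
  haveI : CompactSpace U' := isCompact_iff_compactSpace.mp (Subgroup.isClosed_of_isOpen _ hU'o).isCompact
  have hSD : D.Sigma = {l} := by rw [hDdef, restrictBD_Sigma, hS]
  have hSD' : D'.Sigma = {l} := by rw [hD'def, restrictBD_Sigma, hS']
  -- `α_U` and its group-theoretic cuspidality
  set αU : U ≃ₜ* U' := restrictIso α (rfl : U.map α.toMulEquiv.toMonoidHom = U') with hαUdef
  have hαU : D.IsGraphicallyFiltrationPreserving D' αU := hα.restrictBD G H α hUo hU'o rfl bd bd'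
  have hcuspU : D.IsGroupTheoreticallyCuspidal D' αU :=
    restrictBD_isGroupTheoreticallyCuspidal_of_holds Ω hrank hcuspΩ hS hS' hα U hUo hU'o hDΩ hD'Ω hDs hD's
  -- the canonical presentations of the compactified quotients
  haveI := D.cptKer_normal
  haveI := D'.cptKer_normal
  haveI : T2Space (U ⧸ D.cptKer) := D.t2Space_quotient_cptKer
  haveI : T2Space (U' ⧸ D'.cptKer) := D'.t2Space_quotient_cptKer
  set f : U →* U ⧸ D.cptKer := QuotientGroup.mk' D.cptKer with hfdef
  set f' : U' →* U' ⧸ D'.cptKer := QuotientGroup.mk' D'.cptKer with hf'def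
  have hf : Continuous f := continuous_quot_mk
  have hf' : Continuous f' := continuous_quot_mk
  have hs : Function.Surjective f := QuotientGroup.mk'_surjective _
  have hs' : Function.Surjective f' := QuotientGroup.mk'_surjective _
  have hk : f.ker = D.cptKer := QuotientGroup.ker_mk' _
  have hk' : f'.ker = D'.cptKer := QuotientGroup.ker_mk' _
  have hker : f.ker.map αU.toMulEquiv.toMonoidHom = f'.ker := by
    rw [hk, hk', map_cptKer_of_isGroupTheoreticallyCuspidal hcuspU]
  obtain ⟨ᾱ, hᾱ⟩ := exists_over_of_ker_map_eq αU hf hs hf' hs' hker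
  have hfpc : (D.compactifyAlong f hf hs).IsGraphicallyFiltrationPreserving
      (D'.compactifyAlong f' hf' hs') ᾱ :=
    hαU.compactifyAlong D D' f hf hs f' hf' hs' hker hk.ge hk'.ge hᾱ
  -- the compactified data: of `Ω`-type, sturdy, noncuspidal, `Σ = {l}`
  have hDcΩ : Ω.IsOfPSCType (D.compactifyAlong f hf hs) := hcpt D f hf hs hk hDΩ hDs
  have hD'cΩ : Ω.IsOfPSCType (D'.compactifyAlong f' hf' hs') := hcpt D' f' hf' hs' hk' hD'Ω hD's
  have hDcs : (D.compactifyAlong f hf hs).IsSturdy := (D.isSturdy_compactifyAlong_iff f hf hs).mpr hDs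
  have hD'cs : (D'.compactifyAlong f' hf' hs').IsSturdy :=
    (D'.isSturdy_compactifyAlong_iff f' hf' hs').mpr hD's
  have hSc : (D.compactifyAlong f hf hs).Sigma = {l} := by rw [compactifyAlong_Sigma, hSD]
  have hSc' : (D'.compactifyAlong f' hf' hs').Sigma = {l} := by rw [compactifyAlong_Sigma, hSD']
  obtain ⟨hgrphG, hdualG, -, -⟩ := hrank _ hDcΩ
  obtain ⟨hgrphH, hdualH, -, -⟩ := hrank _ hD'cΩ
  -- node existence corresponds (row T16-L10b), hence `ᾱ` is group-theoretically edge-like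
  have hn : Nonempty (D.compactifyAlong f hf hs).graph.N ↔ Nonempty (D'.compactifyAlong f' hf' hs').graph.N :=
    nonempty_nodes_iff_of_inputs _ _ ᾱ hSc hSc' hDcs hD'cs (D.graph.compactify_isNoncuspidal)
      (D'.graph.compactify_isNoncuspidal) (hunr _ hDcΩ).1 (hrankv _ hDcΩ) hgrphG hdualG (hconn _ hDcΩ)
      (hunr _ hD'cΩ).1 (hrankv _ hD'cΩ) hgrphH hdualH (hconn _ hD'cΩ) hfpc
  have hge : (D.compactifyAlong f hf hs).IsGroupTheoreticallyEdgeLike (D'.compactifyAlong f' hf' hs') ᾱ :=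
    isGroupTheoreticallyEdgeLike_of_isEdgewiseFiltrationPreserving hSc hSc'
      (D.graph.compactify_isNoncuspidal) (D'.graph.compactify_isNoncuspidal) hn (hnodal _ hDcΩ)
      (hnodal _ hD'cΩ) hfpc.2
  exact node_package_of_gtEdgeLike G H α U hUo bd U' hU'o bd' f hf hs f' hf' hs' rfl αU
    (fun u => rfl) ᾱ hᾱ hk hk' hge (hopen _ hDcΩ).2.1 (hopen _ hD'cΩ).2.1

/-! ### The VERTEX package at a sturdy level -/

omit [CompactSpace P] [TotallyDisconnectedSpace P] [CompactSpace P'] [TotallyDisconnectedSpace P'] in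
/-- **The level-`U` vertex package** (abc-iut-w5-d188's `graphic_mod_package_unr`), at a level whose
covering data are sturdy and of `Ω`-type, for `Σ = {l}`, a graphically filtration-preserving and
group-theoretically edge-like `α`: `β_U : Π^unr_{G_U} ⥲ Π^unr_{H_{α U}}` over `α_U` exists and is
verticially filtration-preserving, hence — Thm. 1.6 (iii) assembled (`unrVerticialIff_holds_of_inputs`,
rows T16-L13/L16) — group-theoretically verticial; Prop. 1.2 (i) (unramified case) separates the
vertices. Inputs BY NAME. [cite: MochizukiCombGC2007, Thm 1.6(ii) p.14] -/
theorem vertex_package_of_holds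
    (hprof : ∀ ⦃Q : Type u⦄ [Group Q] [TopologicalSpace Q] [IsTopologicalGroup Q] (K : PSCDatum Q),
      Ω.IsOfPSCType K → CompactSpace Q ∧ TotallyDisconnectedSpace Q)
    (hrank : RankStatementsHold Ω) (hopen : OpenInterDeterminesComponentHolds Ω)
    (hunr : UnrVerticialCharacterizationHolds Ω) (hrankv : UnrVertAbOfRankHolds Ω)
    (hconn : VertCountLeNodeCountSuccHolds Ω) (hres : RestrictBDOfPSCTypeHolds Ω)
    {l : ℕ} (hS : G.Sigma = {l}) (hS' : H.Sigma = {l})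
    (hα : G.IsGraphicallyFiltrationPreserving H α) (hedge : G.IsGroupTheoreticallyEdgeLike H α)
    (U : Subgroup P) [U.Normal] [U.FiniteIndex] (hUo : IsOpen (U : Set P))
    [(U.map α.toMulEquiv.toMonoidHom).Normal] [(U.map α.toMulEquiv.toMonoidHom).FiniteIndex]
    (hU'o : IsOpen ((U.map α.toMulEquiv.toMonoidHom : Subgroup P') : Set P'))
    (hDΩ : Ω.IsOfPSCType (G.restrictBD U hUo bd))
    (hD'Ω : Ω.IsOfPSCType (H.restrictBD (U.map α.toMulEquiv.toMonoidHom) hU'o bd'))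
    (hDs : (G.restrictBD U hUo bd).IsSturdy)
    (hD's : (H.restrictBD (U.map α.toMulEquiv.toMonoidHom) hU'o bd').IsSturdy) :
    ∃ (K' : Subgroup P') (_ : K'.Normal)
      (e : (Σ v, DoubleCoset.Quotient (U : Set P) (G.vertGp v : Set P)) ≃
        (Σ w, DoubleCoset.Quotient ((U.map α.toMulEquiv.toMonoidHom : Subgroup P') : Set P')
          (H.vertGp w : Set P'))),
      (∀ (v : G.graph.V) (x : P) (w : H.graph.V) (y : P'),
        e ⟨v, DoubleCoset.mk U (G.vertGp v) x⟩ =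
            ⟨w, DoubleCoset.mk (U.map α.toMulEquiv.toMonoidHom) (H.vertGp w) y⟩ →
          ∃ u' ∈ U.map α.toMulEquiv.toMonoidHom,
            (U ⊓ ConjAct.toConjAct x • G.vertGp v).map α.toMulEquiv.toMonoidHom ⊔ K' =
              ConjAct.toConjAct u' •
                ((U.map α.toMulEquiv.toMonoidHom ⊓ ConjAct.toConjAct y • H.vertGp w) ⊔ K')) ∧
      (∀ (w₁ : H.graph.V) (y₁ : P') (w₂ : H.graph.V) (y₂ : P'),
        (∃ u' ∈ U.map α.toMulEquiv.toMonoidHom,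
            (U.map α.toMulEquiv.toMonoidHom ⊓ ConjAct.toConjAct y₁ • H.vertGp w₁) ⊔ K' =
              ConjAct.toConjAct u' •
                ((U.map α.toMulEquiv.toMonoidHom ⊓ ConjAct.toConjAct y₂ • H.vertGp w₂) ⊔ K')) →
          (⟨w₁, DoubleCoset.mk (U.map α.toMulEquiv.toMonoidHom) (H.vertGp w₁) y₁⟩ :
              Σ w, DoubleCoset.Quotient ((U.map α.toMulEquiv.toMonoidHom : Subgroup P') : Set P')
                (H.vertGp w : Set P')) =
            ⟨w₂, DoubleCoset.mk (U.map α.toMulEquiv.toMonoidHom) (H.vertGp w₂) y₂⟩) := by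
  set U' : Subgroup P' := U.map α.toMulEquiv.toMonoidHom with hU'def
  set D := G.restrictBD U hUo bd with hDdef
  set D' := H.restrictBD U' hU'o bd' with hD'def
  have hSD : D.Sigma = {l} := by rw [hDdef, restrictBD_Sigma, hS]
  have hSD' : D'.Sigma = {l} := by rw [hD'def, restrictBD_Sigma, hS']
  set αU : U ≃ₜ* U' := restrictIso α (rfl : U.map α.toMulEquiv.toMonoidHom = U') with hαUdef
  have hαU : D.IsGraphicallyFiltrationPreserving D' αU := hα.restrictBD G H α hUo hU'o rfl bd bd'
  have hedgeU : D.IsGroupTheoreticallyEdgeLike D' αU := hedge.restrictBD G H α hUo hU'o rfl bd bd'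
  -- `β_U` over `α_U`, verticially filtration-preserving
  obtain ⟨β, hβ⟩ := hedgeU.exists_unrQuotient_equiv
  have hβfp : D.IsUnrVerticiallyFiltrationPreserving D' β :=
    isUnrVerticiallyFiltrationPreserving_of_isVerticiallyFiltrationPreserving
      (map_unrKer_of_isGroupTheoreticallyEdgeLike hedgeU) hβ hαU.1
  -- Thm. 1.6 (iii), assembled, at the level
  have h3 : D.UnrVerticiallyFiltrationPreservingIffVerticial D' β :=
    unrVerticialIff_holds_of_inputs Ω hprof hrank hconn hunr hrankv hres hDΩ hD'Ω hSD hSD' β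
  have hgt : D.IsUnrGroupTheoreticallyVerticial D' β := (h3 hDs hD's).mp hβfp
  exact graphic_mod_package_unr G H α U hUo bd U' hU'o bd' rfl αU (fun u => rfl) β hβ hgt
    (hopen _ hDΩ).2.2 hDs (hopen _ hD'Ω).2.2 hD's

end PSCDatum

end Literature.AnabelianGeometry.SemiGraphs

end
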